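import Mathlib
import Literature.NumberTheory.LFunctions.Zhang2022.Section14U004LineBounds
import Literature.NumberTheory.LFunctions.Zhang2022.Section7I1Line
import HarnessLib

/-!
# Zhang (2022) §14 u004 (p. 76, tex L3858): `Ĩ₂(ψ)` = the line integral on `σ = 3/2` with
# `Z(s,ψχ)⁻¹ ↦ τ((ψχ)‾)(Dp)^{s−1}ϑ*(1−s)`, up to `O(ε)` — kernel-checked

Topic `Literature/NumberTheory/LFunctions/Zhang2022` (Landau–Siegel audit tree; verdict-neutral).
Y. Zhang, *Discrete mean estimates and the Landau–Siegel zero*, arXiv:2211.02515v1 (2022)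
[Zhang2022LandauSiegel] — **an unrefereed manuscript under adjudication; nothing here asserts or
denies its Theorems 1–2.** ZHANG-L discharge lane (WP14); THEOREM-ONLY (no definition, no named fact).

§14 p. 76 (tex L3858), proof of Proposition 14.1, first half of the step `Z22:§14.u004`:

> We use (2.5) with `θ = ψχ` and then replace the segment `𝔍(1)` by the vertical line `σ = 3/2`
> with a negligible error.

The §14 twin of the tree's `Section7I1Line.step7u021_holds` (§7 p. 35, tex L1920), for the banked
object `Typed.Sec14.i2Tilde χ x 𝐤* 𝐚*` (the integrand of `Skeleton.Theta2` for one `ψ ∈ Ψ`): for every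
`B` there are `c = 1/16`, `C = 34·324·144·e·π²·S·B²` (`S = Σ_m τ₅(m)m^{−3/2}`) such that for all
`D ≥ ⌈e⁶⁴⌉`, all real primitive `χ (mod D)`, all `ψ ∈ Ψ` and all `𝐤*, 𝐚*` with (14.1)–(14.2) (bound `B`),
`‖Ĩ₂(ψ) − (1/2π)∫_ℝ G(3/2+it)dt‖ ≤ C e^{−𝓛¹⁰/16}`, where
`G(s) = τ((ψχ)‾)(Dp)^{s−1}ϑ*(1−s)(Σ_m κ*(m)ψ(m)m^{−s})(Σ_{n≤2P₄} a*(n)ψ̄(n)n^{s−1})ω(s)`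
(`i2Tilde_sub_line_le`). Route, exactly as in §7: on `𝔍(1)` (`s = 3/2 + i(2πt₀+v)`, `|v| ≤ 𝓛₁ = 𝓛⁴⁰⁵`,
`Im s ≥ 𝓛⁵¹⁹ ≥ 1`) the exact identities (2.5) `Z(s,θ)⁻¹ = τ(θ̄)(Dp)^{s−1}ϑ(1−s)(1+r)⁻¹` for the primitive
`θ = ψχ (mod Dp)` (`GammaFactor.Zfac_inv_eq`, `Skeleton.psiChiPrimitive_holds`) and (5.5)
`ϑ(1−s) = ϑ*(1−s)(1+q)` give `F = G·(1+q)(1+r)⁻¹` with `|(1+q)(1+r)⁻¹ − 1| ≤ 9e^{−π Im s}`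
(`Section7I1Line.norm_rho_sub_one_le`); the segment integral of `G` is the line integral minus the two
tails `|t − 2πt₀| > 𝓛₁`, each `≤ K₃·8𝓛³⁹⁵e^{−𝓛¹⁰/8}` by the Gaussian majorant of
`Section14U004LineBounds`; finally `K₃𝓛⁴⁰⁵ ≪ B²·D·P³·𝓛²⁴⁸¹` and `D·P³𝓛²⁴⁸¹e^{−𝓛¹⁰/8} ≤ e^{−𝓛¹⁰/16}`
for `𝓛 ≥ 64`.

| decl | content |
|---|---|
| `segment_integrand_eq` | on `Im s > 0`: `Z(s,ψχ)⁻¹MAω = (τ((ψχ)‾)(Dp)^{s−1}ϑ*(1−s)MAω)·(1+q)(1+r)⁻¹` |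
| `norm_segment_integrand_sub_le` | the replacement error `≤ ‖GMAω‖·9e^{−π Im s}` (`Im s ≥ 1`) |
| `continuousAt_segment_integrand` | continuity of the integrand of `Ĩ₂(ψ)` along `𝔍(1)` |
| `i2Tilde_sub_line_le` | **`Ĩ₂(ψ) = (1/2π)∫_ℝ G(3/2+it)dt + O(e^{−𝓛¹⁰/16})`** |

No fact beyond Mathlib and tree theorems is used.

## References

* Y. Zhang, arXiv:2211.02515v1 (2022), §14 p. 76, tex L3854–L3858; §7 p. 35, tex L1920; §2 (2.5);
  §5 (5.5). [cite: Zhang2022LandauSiegel, §14 u004 p.76]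
-/

noncomputable section

open Complex Real MeasureTheory Set Filter
open scoped ComplexConjugate

namespace Literature.NumberTheory.LFunctions.Zhang2022.Typed.Sec14.U004

open Skeleton

variable {D : ℕ} [NeZero D] (χ : DirichletCharacter ℂ D)

/-! ## The integrand of `Ĩ₂(ψ)` against the modified integrand on the segment `𝔍(1)` -/

/-- **The integrand of `Ĩ₂(ψ)` against the modified integrand**, EXACT (tex L3858, "We use (2.5)
with `θ = ψχ`"): for `D ≥ 3`, `χ` primitive, `ψ (mod p) ∈ Ψ` and `Im s > 0`,
`Z(s,ψχ)⁻¹·M(s)A(s)ω(s) = (τ((ψχ)‾)(Dp)^{s−1}ϑ*(1−s)·M(s)A(s)ω(s))·(1+q)(1+r)⁻¹`, by (2.5) for the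
primitive `ψχ (mod Dp)` (`GammaFactor.Zfac_inv_eq`, `psiChiPrimitive_holds`) and (5.5)
(`GammaFactor.vartheta_one_sub_eq_star_mul`). [cite: Zhang2022LandauSiegel, §14 u004 p.76, tex L3858] -/
theorem segment_integrand_eq (hD : 3 ≤ D) (hχ : χ.IsPrimitive) (x : Chr D) (κs as : ℕ → ℂ)
    {s : ℂ} (hs : 0 < s.im) :
    (Zpc χ x s)⁻¹ * (∑' m : ℕ, κs m * x.ψ (m : ZMod x.p) * (m : ℂ) ^ (-s)) *
        (∑ n ∈ Finset.Icc 1 ⌊2 * P4 D⌋₊, as n * conj (x.ψ (n : ZMod x.p)) * (n : ℂ) ^ (s - 1)) *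
        omegaW D s =
      (GammaFactor.tau (psiChi χ x)⁻¹ * ((D * x.p : ℕ) : ℂ) ^ (s - 1) *
        GammaFactor.varthetaStarOneSub s *
        (∑' m : ℕ, κs m * x.ψ (m : ZMod x.p) * (m : ℂ) ^ (-s)) *
        (∑ n ∈ Finset.Icc 1 ⌊2 * P4 D⌋₊, as n * conj (x.ψ (n : ZMod x.p)) * (n : ℂ) ^ (s - 1)) *
        omegaW D s) *
      ((1 + GammaFactor.qexp s) * (1 + GammaFactor.corr (psiChi χ x) s)⁻¹) := by
  have hprim : (psiChi χ x).IsPrimitive := psiChiPrimitive_holds D χ x hD hχ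
  rw [Zpc, GammaFactor.Zfac_inv_eq hprim hs, GammaFactor.vartheta_one_sub_eq_star_mul s]
  ring

/-- **Size of the replacement error on the segment**: for `D ≥ 3`, `χ` primitive, `ψ (mod p) ∈ Ψ`
and `Im s ≥ 1`, `‖Z(s,ψχ)⁻¹MAω − GMAω‖ ≤ ‖GMAω‖·9e^{−π Im s}` (notation of `segment_integrand_eq`;
the factor bound is the tree's `Section7I1Line.norm_rho_sub_one_le`).
[cite: Zhang2022LandauSiegel, §14 u004 p.76, tex L3858] -/
theorem norm_segment_integrand_sub_le (hD : 3 ≤ D) (hχ : χ.IsPrimitive) (x : Chr D)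
    (κs as : ℕ → ℂ) {s : ℂ} (hs : 1 ≤ s.im) :
    ‖(Zpc χ x s)⁻¹ * (∑' m : ℕ, κs m * x.ψ (m : ZMod x.p) * (m : ℂ) ^ (-s)) *
          (∑ n ∈ Finset.Icc 1 ⌊2 * P4 D⌋₊, as n * conj (x.ψ (n : ZMod x.p)) * (n : ℂ) ^ (s - 1)) *
          omegaW D s -
        GammaFactor.tau (psiChi χ x)⁻¹ * ((D * x.p : ℕ) : ℂ) ^ (s - 1) *
          GammaFactor.varthetaStarOneSub s *
          (∑' m : ℕ, κs m * x.ψ (m : ZMod x.p) * (m : ℂ) ^ (-s)) *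
          (∑ n ∈ Finset.Icc 1 ⌊2 * P4 D⌋₊, as n * conj (x.ψ (n : ZMod x.p)) * (n : ℂ) ^ (s - 1)) *
          omegaW D s‖ ≤
      ‖GammaFactor.tau (psiChi χ x)⁻¹ * ((D * x.p : ℕ) : ℂ) ^ (s - 1) *
          GammaFactor.varthetaStarOneSub s *
          (∑' m : ℕ, κs m * x.ψ (m : ZMod x.p) * (m : ℂ) ^ (-s)) *
          (∑ n ∈ Finset.Icc 1 ⌊2 * P4 D⌋₊, as n * conj (x.ψ (n : ZMod x.p)) * (n : ℂ) ^ (s - 1)) *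
          omegaW D s‖ * (9 * Real.exp (-π * s.im)) := by
  rw [segment_integrand_eq χ hD hχ x κs as (lt_of_lt_of_le one_pos hs)]
  set G := GammaFactor.tau (psiChi χ x)⁻¹ * ((D * x.p : ℕ) : ℂ) ^ (s - 1) *
    GammaFactor.varthetaStarOneSub s *
    (∑' m : ℕ, κs m * x.ψ (m : ZMod x.p) * (m : ℂ) ^ (-s)) *
    (∑ n ∈ Finset.Icc 1 ⌊2 * P4 D⌋₊, as n * conj (x.ψ (n : ZMod x.p)) * (n : ℂ) ^ (s - 1)) *
    omegaW D s with hG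
  have e : G * ((1 + GammaFactor.qexp s) * (1 + GammaFactor.corr (psiChi χ x) s)⁻¹) - G =
      G * ((1 + GammaFactor.qexp s) * (1 + GammaFactor.corr (psiChi χ x) s)⁻¹ - 1) := by ring
  rw [e, norm_mul]
  exact mul_le_mul_of_nonneg_left (Section7I1Line.norm_rho_sub_one_le (psiChi χ x) hs)
    (norm_nonneg _)

/-- **Continuity of the integrand of `Ĩ₂(ψ)` along the segment** `v ↦ 1 + s₀ + iv` on `v > −2πt₀`
(there `Im s > 0`, so `Z(s,ψχ)⁻¹` is analytic: tree `Eq143.differentiableAt_Zpc_inv`), for `D ≥ 3`,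
`χ` primitive, `|κ*| ≤ Bτ₅`. [cite: Zhang2022LandauSiegel, §14 u003 p.76, tex L3854] -/
theorem continuousAt_segment_integrand (hD : 3 ≤ D) (hχ : χ.IsPrimitive) (x : Chr D) {B : ℝ}
    {κs : ℕ → ℂ} (hκ : Eq141 B κs) (as : ℕ → ℂ) {v : ℝ} (hv : 0 < 2 * π * t0 D + v) :
    ContinuousAt (fun v : ℝ =>
      (Zpc χ x ((1 : ℂ) + SmoothWeight.s0 (t0 D) + (v : ℂ) * I))⁻¹ *
        (∑' m : ℕ, κs m * x.ψ (m : ZMod x.p) *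
          (m : ℂ) ^ (-((1 : ℂ) + SmoothWeight.s0 (t0 D) + (v : ℂ) * I))) *
        (∑ n ∈ Finset.Icc 1 ⌊2 * P4 D⌋₊, as n * conj (x.ψ (n : ZMod x.p)) *
          (n : ℂ) ^ (((1 : ℂ) + SmoothWeight.s0 (t0 D) + (v : ℂ) * I) - 1)) *
        omegaW D ((1 : ℂ) + SmoothWeight.s0 (t0 D) + (v : ℂ) * I)) v := by
  -- rewrite the segment points as points of the line `σ = 3/2` at height `2πt₀ + v`
  have hfun : (fun v : ℝ =>
      (Zpc χ x ((1 : ℂ) + SmoothWeight.s0 (t0 D) + (v : ℂ) * I))⁻¹ *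
        (∑' m : ℕ, κs m * x.ψ (m : ZMod x.p) *
          (m : ℂ) ^ (-((1 : ℂ) + SmoothWeight.s0 (t0 D) + (v : ℂ) * I))) *
        (∑ n ∈ Finset.Icc 1 ⌊2 * P4 D⌋₊, as n * conj (x.ψ (n : ZMod x.p)) *
          (n : ℂ) ^ (((1 : ℂ) + SmoothWeight.s0 (t0 D) + (v : ℂ) * I) - 1)) *
        omegaW D ((1 : ℂ) + SmoothWeight.s0 (t0 D) + (v : ℂ) * I)) =
      (fun t : ℝ => (Zpc χ x ((3 / 2 : ℂ) + t * I))⁻¹ *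
        (∑' m : ℕ, κs m * x.ψ (m : ZMod x.p) * (m : ℂ) ^ (-((3 / 2 : ℂ) + t * I))) *
        (∑ n ∈ Finset.Icc 1 ⌊2 * P4 D⌋₊, as n * conj (x.ψ (n : ZMod x.p)) *
          (n : ℂ) ^ (((3 / 2 : ℂ) + t * I) - 1)) *
        omegaW D ((3 / 2 : ℂ) + t * I)) ∘
      (fun v : ℝ => 2 * π * t0 D + v) := by
    ext v
    simp only [Function.comp_apply, Section7I1Line.seg_point_eq]
  rw [hfun]
  have hshift : Continuous fun v : ℝ => 2 * π * t0 D + v := by fun_prop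
  refine ContinuousAt.comp (f := fun v : ℝ => 2 * π * t0 D + v) ?_ hshift.continuousAt
  set t : ℝ := 2 * π * t0 D + v with ht
  have him : 0 < ((3 / 2 : ℂ) + (t : ℂ) * I).im := by simp; exact hv
  -- `Z(s,ψχ)⁻¹` is continuous at the point
  have hZ : ContinuousAt (fun t : ℝ => (Zpc χ x ((3 / 2 : ℂ) + t * I))⁻¹) t := by
    have hline : Continuous fun t : ℝ => (3 / 2 : ℂ) + (t : ℂ) * I := by fun_prop
    have h1 : ContinuousAt (fun s : ℂ => (Zpc χ x s)⁻¹) ((3 / 2 : ℂ) + (t : ℂ) * I) :=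
      (Eq143.differentiableAt_Zpc_inv hD hχ x him).continuousAt
    exact ContinuousAt.comp (f := fun t : ℝ => (3 / 2 : ℂ) + (t : ℂ) * I) h1 hline.continuousAt
  have hM := (continuous_twist_line x hκ).continuousAt (x := t)
  have hA := (continuous_apoly_line x as).continuousAt (x := t)
  have hω := (Section7I1Kernel.continuous_omega_line D).continuousAt (x := t)
  exact ((hZ.mul hM).mul hA).mul hω

/-! ## The exponent bookkeeping -/

/-- For `𝓛 ≥ 64` (and `D ≥ 1`, so `D = e^{𝓛}`): `D·P³·𝓛²⁴⁸¹·e^{−𝓛¹⁰/8} ≤ e^{−𝓛¹⁰/16}`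
(`P = e^{𝓛⁹}`, `𝓛²⁴⁸¹ ≤ e^{2481𝓛}`, `2482𝓛 + 3𝓛⁹ ≤ 4𝓛⁹ ≤ 𝓛¹⁰/16`).
[cite: Zhang2022LandauSiegel, §14 u004 p.76, tex L3858] -/
private theorem prefactor_le {D : ℕ} (hD1 : 1 ≤ D) (hℓ : 64 ≤ ell D) :
    (D : ℝ) * bigP D ^ 3 * ell D ^ 2481 * Real.exp (-(ell D ^ 10) / 8) ≤
      Real.exp (-(1 / 16) * ell D ^ 10) := by
  have hℓ1 : (1 : ℝ) ≤ ell D := by linarith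
  have hℓ0 : (0 : ℝ) < ell D := by linarith
  have hD0 : (0 : ℝ) < D := by exact_mod_cast hD1
  have hDexp : (D : ℝ) = Real.exp (ell D) := by rw [ell, Real.exp_log hD0]
  have hP : bigP D ^ 3 = Real.exp (3 * ell D ^ 9) := by rw [bigP, ← Real.exp_nat_mul]; norm_num
  have hpoly_pos : 0 < ell D ^ 2481 := by positivity
  have hlog : Real.log (ell D ^ 2481) ≤ 2481 * ell D := by
    rw [Real.log_pow]
    have hl : Real.log (ell D) ≤ ell D := by
      have := Real.log_le_sub_one_of_pos hℓ0; linarith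
    push_cast
    nlinarith
  have h2 : (4096 : ℝ) ≤ ell D ^ 2 := by nlinarith
  have h2' : ell D ^ 2 ≤ ell D ^ 8 := pow_le_pow_right₀ hℓ1 (by norm_num)
  have h9 : 2482 * ell D ≤ ell D ^ 9 := by
    have e : ell D ^ 9 = ell D ^ 8 * ell D := by ring
    rw [e]; nlinarith
  have h10 : 64 * ell D ^ 9 ≤ ell D ^ 10 := by
    have e : ell D ^ 10 = ell D * ell D ^ 9 := by ring
    have : 0 ≤ ell D ^ 9 := by positivity
    rw [e]; nlinarith
  have key : ell D + 3 * ell D ^ 9 + Real.log (ell D ^ 2481) + -(ell D ^ 10) / 8 ≤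
      -(1 / 16) * ell D ^ 10 := by nlinarith
  calc (D : ℝ) * bigP D ^ 3 * ell D ^ 2481 * Real.exp (-(ell D ^ 10) / 8)
      = Real.exp (ell D) * Real.exp (3 * ell D ^ 9) * Real.exp (Real.log (ell D ^ 2481)) *
          Real.exp (-(ell D ^ 10) / 8) := by rw [← hDexp, ← hP, Real.exp_log hpoly_pos]
    _ = Real.exp (ell D + 3 * ell D ^ 9 + Real.log (ell D ^ 2481) + -(ell D ^ 10) / 8) := by
        rw [Real.exp_add, Real.exp_add, Real.exp_add]
    _ ≤ Real.exp (-(1 / 16) * ell D ^ 10) := Real.exp_le_exp.mpr key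

/-- The size of the constant `K₃` of the Gaussian majorant: for `D ≥ 9` and `ψ (mod p) ∈ Ψ`,
`16π²S·B²·(Dp)·⌊2P₄⌋^{3/2}·(√π/𝓛₂)·(e·144𝓛¹⁰³⁸) ≤ 324·144·e·π²·S·B²·(D·P³·𝓛²⁰⁷⁶)`
(`p ≤ 9P/8`, `⌊2P₄⌋^{3/2} ≤ (⌊2P₄⌋+1)² ≤ (3Pt₀)² = 9P²𝓛¹⁰³⁸`, `√π/𝓛₂ ≤ 2`).
[cite: Zhang2022LandauSiegel, §14 u004 p.76, tex L3858] -/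
private theorem K3_le {D : ℕ} (hD : 9 ≤ D) (x : Chr D) {S B : ℝ} (hS : 0 ≤ S) :
    (16 * π ^ 2 * S * B ^ 2 * ((D * x.p : ℕ) : ℝ) * (⌊2 * P4 D⌋₊ : ℝ) ^ (3 / 2 : ℝ) *
        (Real.sqrt π / ell2 D)) * (Real.exp 1 * (144 * ell D ^ 1038)) ≤
      324 * 144 * Real.exp 1 * π ^ 2 * S * B ^ 2 * ((D : ℝ) * bigP D ^ 3 * ell D ^ 2076) := by
  have hℓ := Section6TailBounds.two_le_ell hD
  have hℓ0 : 0 < ell D := by linarith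
  have hP : 0 < bigP D := Real.exp_pos _
  have hP1 : 1 ≤ bigP D := Real.one_le_exp (by positivity)
  have hT1 : 1 ≤ bigT D := Real.one_le_exp (Real.rpow_nonneg (Real.log_natCast_nonneg D) _)
  have ht0 : t0 D = ell D ^ 519 := rfl
  have ht1 : 1 ≤ t0 D := by rw [ht0]; exact one_le_pow₀ (by linarith)
  have ht00 : 0 ≤ t0 D := by linarith
  obtain ⟨_, hp2⟩ := Section6TailBounds.p_range hD x
  have hℓ₂1 : 1 ≤ ell2 D := by rw [ell2]; exact one_le_pow₀ (by linarith)
  -- `Dp ≤ D·(9/8)P`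
  have hDp : ((D * x.p : ℕ) : ℝ) ≤ (D : ℝ) * (9 / 8 * bigP D) := by
    rw [Nat.cast_mul]
    exact mul_le_mul_of_nonneg_left hp2 (Nat.cast_nonneg D)
  -- `⌊2P₄⌋^{3/2} ≤ 9P²t₀²`
  set N : ℕ := ⌊2 * P4 D⌋₊ with hN
  have hP4 : 0 ≤ 2 * P4 D := by rw [P4]; positivity
  have hNle : (N : ℝ) ≤ 2 * bigP D * t0 D := by
    refine (Nat.floor_le hP4).trans ?_
    rw [P4, show 2 * (bigP D / bigT D ^ 2 * t0 D) = 2 * bigP D * t0 D / bigT D ^ 2 by ring]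
    exact div_le_self (by positivity) (one_le_pow₀ hT1)
  have hPt : 1 ≤ bigP D * t0 D := one_le_mul_of_one_le_of_one_le hP1 ht1
  have hN1 : (N : ℝ) + 1 ≤ 3 * (bigP D * t0 D) := by linarith
  have hN0 : (0 : ℝ) ≤ N := Nat.cast_nonneg N
  have hN32 : (N : ℝ) ^ (3 / 2 : ℝ) ≤ 9 * bigP D ^ 2 * t0 D ^ 2 := by
    have h1 : (N : ℝ) ^ (3 / 2 : ℝ) ≤ ((N : ℝ) + 1) ^ (3 / 2 : ℝ) :=
      Real.rpow_le_rpow hN0 (by linarith) (by norm_num)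
    have h2 : ((N : ℝ) + 1) ^ (3 / 2 : ℝ) ≤ ((N : ℝ) + 1) ^ ((2 : ℕ) : ℝ) :=
      Real.rpow_le_rpow_of_exponent_le (by linarith) (by norm_num)
    rw [Real.rpow_natCast] at h2
    have h3 : ((N : ℝ) + 1) ^ 2 ≤ (3 * (bigP D * t0 D)) ^ 2 :=
      pow_le_pow_left₀ (by linarith) hN1 2
    nlinarith
  -- `√π/𝓛₂ ≤ 2`
  have hsq : Real.sqrt π / ell2 D ≤ 2 := by
    have h1 : Real.sqrt π ≤ 2 := by
      rw [Real.sqrt_le_left (by norm_num)]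
      linarith [Real.pi_lt_four]
    calc Real.sqrt π / ell2 D ≤ Real.sqrt π / 1 :=
          div_le_div_of_nonneg_left (Real.sqrt_nonneg _) one_pos hℓ₂1
      _ ≤ 2 := by rw [div_one]; exact h1
  have ht2 : t0 D ^ 2 * ell D ^ 1038 = ell D ^ 2076 := by rw [ht0]; ring
  have h0 : 0 ≤ 16 * π ^ 2 * S * B ^ 2 := by positivity
  have hD0 : (0 : ℝ) ≤ D := Nat.cast_nonneg D
  have hDP0 : 0 ≤ (D : ℝ) * (9 / 8 * bigP D) := mul_nonneg hD0 (by positivity)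
  have h4 : 0 ≤ Real.exp 1 * (144 * ell D ^ 1038) :=
    mul_nonneg (Real.exp_pos _).le (mul_nonneg (by norm_num) (pow_nonneg hℓ0.le _))
  have hmid : ((D * x.p : ℕ) : ℝ) * (N : ℝ) ^ (3 / 2 : ℝ) * (Real.sqrt π / ell2 D) ≤
      ((D : ℝ) * (9 / 8 * bigP D)) * (9 * bigP D ^ 2 * t0 D ^ 2) * 2 := by
    have hN32nn : 0 ≤ (N : ℝ) ^ (3 / 2 : ℝ) := Real.rpow_nonneg hN0 _
    have hsq0 : 0 ≤ Real.sqrt π / ell2 D := div_nonneg (Real.sqrt_nonneg _) (by linarith)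
    have h9 : 0 ≤ 9 * bigP D ^ 2 * t0 D ^ 2 :=
      mul_nonneg (mul_nonneg (by norm_num) (sq_nonneg _)) (sq_nonneg _)
    exact mul_le_mul (mul_le_mul hDp hN32 hN32nn hDP0) hsq hsq0 (mul_nonneg hDP0 h9)
  calc (16 * π ^ 2 * S * B ^ 2 * ((D * x.p : ℕ) : ℝ) * (N : ℝ) ^ (3 / 2 : ℝ) *
        (Real.sqrt π / ell2 D)) * (Real.exp 1 * (144 * ell D ^ 1038))
      = (16 * π ^ 2 * S * B ^ 2) * (((D * x.p : ℕ) : ℝ) * (N : ℝ) ^ (3 / 2 : ℝ) *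
          (Real.sqrt π / ell2 D)) * (Real.exp 1 * (144 * ell D ^ 1038)) := by ring
    _ ≤ (16 * π ^ 2 * S * B ^ 2) * (((D : ℝ) * (9 / 8 * bigP D)) * (9 * bigP D ^ 2 * t0 D ^ 2) * 2) *
          (Real.exp 1 * (144 * ell D ^ 1038)) :=
        mul_le_mul_of_nonneg_right (mul_le_mul_of_nonneg_left hmid h0) h4
    _ = 324 * 144 * Real.exp 1 * π ^ 2 * S * B ^ 2 *
          ((D : ℝ) * bigP D ^ 3 * (t0 D ^ 2 * ell D ^ 1038)) := by ring
    _ = 324 * 144 * Real.exp 1 * π ^ 2 * S * B ^ 2 * ((D : ℝ) * bigP D ^ 3 * ell D ^ 2076) := by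
        rw [ht2]

/-! ## `Z22:§14.u004`, first half: the segment `𝔍(1)` replaced by the line `σ = 3/2` -/

set_option maxHeartbeats 400000 in
/-- **`Ĩ₂(ψ)` equals the line integral on `σ = 3/2` of the modified integrand, up to `O(ε)`**
(§14 p. 76, tex L3858: "We use (2.5) with `θ = ψχ` and then replace the segment `𝔍(1)` by the
vertical line `σ = 3/2` with a negligible error"): for every `B`, with `c = 1/16`,
`C = 34·324·144·e·π²·S·B²` (`S = Σ_m τ₅(m)m^{−3/2}`) and all `D ≥ ⌈e⁶⁴⌉`, all real primitive `χ`,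
all `ψ ∈ Ψ` and all `𝐤*, 𝐚*` with (14.1)–(14.2):
`‖Ĩ₂(ψ) − (1/2π)∫_ℝ τ((ψχ)‾)(Dp)^{s−1}ϑ*(1−s)(Σ_m κ*(m)ψ(m)m^{−s})(Σ_n a*(n)ψ̄(n)n^{s−1})ω(s)dt‖
≤ C e^{−𝓛¹⁰/16}` (`s = 3/2 + it`). [cite: Zhang2022LandauSiegel, §14 u004 p.76, tex L3858] -/
theorem i2Tilde_sub_line_le (B : ℝ) : ∃ c : ℝ, 0 < c ∧ ∃ C : ℝ, ForAllLarge fun D _ χ =>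
    ∀ (x : Chr D) (κs as : ℕ → ℂ), Eq141 B κs → Eq142 D B as →
      ‖i2Tilde χ x κs as - 1 / (2 * π) * ∫ t : ℝ,
          GammaFactor.tau (psiChi χ x)⁻¹ * ((D * x.p : ℕ) : ℂ) ^ (((3 / 2 : ℂ) + t * I) - 1) *
            GammaFactor.varthetaStarOneSub ((3 / 2 : ℂ) + t * I) *
            (∑' m : ℕ, κs m * x.ψ (m : ZMod x.p) * (m : ℂ) ^ (-((3 / 2 : ℂ) + t * I))) *
            (∑ n ∈ Finset.Icc 1 ⌊2 * P4 D⌋₊, as n * conj (x.ψ (n : ZMod x.p)) *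
              (n : ℂ) ^ (((3 / 2 : ℂ) + t * I) - 1)) *
            omegaW D ((3 / 2 : ℂ) + t * I)‖ ≤ C * Real.exp (-c * ell D ^ 10) := by
  refine ⟨1 / 16, by norm_num,
    34 * 324 * 144 * Real.exp 1 * π ^ 2 *
      (∑' m : ℕ, MeanSquareMajorant.tau 5 m * (m : ℝ) ^ (-(3 / 2 : ℝ))) * B ^ 2,
    ⌈Real.exp 64⌉₊, fun D _ χ hD _ hχ x κs as hκ ha => ?_⟩
  -- parameters
  have hexpD : Real.exp 64 ≤ (D : ℝ) := le_trans (Nat.le_ceil _) (by exact_mod_cast hD)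
  have hDpos : (0 : ℝ) < D := lt_of_lt_of_le (Real.exp_pos _) hexpD
  have hℓ64 : 64 ≤ ell D := by rw [ell, Real.le_log_iff_exp_le hDpos]; exact hexpD
  have hD9 : 9 ≤ D := by
    have h65 : (64 : ℝ) + 1 ≤ Real.exp 64 := Real.add_one_le_exp _
    have : ((9 : ℕ) : ℝ) ≤ (D : ℝ) := by push_cast; linarith
    exact_mod_cast this
  have hD3 : 3 ≤ D := le_trans (by norm_num) hD9
  have hD1 : 1 ≤ D := le_trans (by norm_num) hD9
  have hℓ := Section6TailBounds.two_le_ell hD9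
  have hℓ0 : 0 < ell D := by linarith
  have hB : 0 ≤ B := (norm_nonneg _).trans (ha.1 0)
  set S : ℝ := ∑' m : ℕ, MeanSquareMajorant.tau 5 m * (m : ℝ) ^ (-(3 / 2 : ℝ)) with hS
  have hS0 : 0 ≤ S := tsum_nonneg fun m => mul_nonneg (MeanSquareMajorant.tau_nonneg 5 m)
    (Real.rpow_nonneg (Nat.cast_nonneg m) _)
  -- the two integrands
  set G : ℝ → ℂ := fun t =>
    GammaFactor.tau (psiChi χ x)⁻¹ * ((D * x.p : ℕ) : ℂ) ^ (((3 / 2 : ℂ) + t * I) - 1) *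
      GammaFactor.varthetaStarOneSub ((3 / 2 : ℂ) + t * I) *
      (∑' m : ℕ, κs m * x.ψ (m : ZMod x.p) * (m : ℂ) ^ (-((3 / 2 : ℂ) + t * I))) *
      (∑ n ∈ Finset.Icc 1 ⌊2 * P4 D⌋₊, as n * conj (x.ψ (n : ZMod x.p)) *
        (n : ℂ) ^ (((3 / 2 : ℂ) + t * I) - 1)) *
      omegaW D ((3 / 2 : ℂ) + t * I) with hGdef
  set F : ℝ → ℂ := fun v =>
    (Zpc χ x ((1 : ℂ) + SmoothWeight.s0 (t0 D) + (v : ℂ) * I))⁻¹ *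
      (∑' m : ℕ, κs m * x.ψ (m : ZMod x.p) *
        (m : ℂ) ^ (-((1 : ℂ) + SmoothWeight.s0 (t0 D) + (v : ℂ) * I))) *
      (∑ n ∈ Finset.Icc 1 ⌊2 * P4 D⌋₊, as n * conj (x.ψ (n : ZMod x.p)) *
        (n : ℂ) ^ (((1 : ℂ) + SmoothWeight.s0 (t0 D) + (v : ℂ) * I) - 1)) *
      omegaW D ((1 : ℂ) + SmoothWeight.s0 (t0 D) + (v : ℂ) * I) with hFdef
  set c : ℝ := 2 * π * t0 D with hc
  set L₁ : ℝ := ell1 D with hL₁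
  have hI2 : i2Tilde χ x κs as = (1 / (2 * π) : ℂ) * ∫ v in (-L₁)..L₁, F v := rfl
  have hL₁0 : 0 ≤ L₁ := by rw [hL₁, ell1]; positivity
  have hcL : ell D ^ 519 ≤ c - L₁ := by
    rw [hc, hL₁, t0, ell1]
    have h405 : ell D ^ 405 ≤ ell D ^ 519 := Section6TailBounds.ell_pow_le_pow hD9 (by norm_num)
    nlinarith [Real.pi_gt_three, pow_pos hℓ0 519]
  have h519 : (1 : ℝ) ≤ ell D ^ 519 := one_le_pow₀ (by linarith)
  -- integrability and the Gaussian majorant of `G`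
  have hGint : Integrable G := integrable_lineIntegrand χ hD9 hχ x hκ ha.1
  set K₃ : ℝ := (16 * π ^ 2 * S * B ^ 2 * ((D * x.p : ℕ) : ℝ) * (⌊2 * P4 D⌋₊ : ℝ) ^ (3 / 2 : ℝ) *
    (Real.sqrt π / ell2 D)) * (Real.exp 1 * (144 * ell D ^ 1038)) with hK₃
  have hℓ₂ : 0 < ell2 D := by rw [ell2]; positivity
  have hK₃0 : 0 ≤ K₃ := by
    have h1 : 0 ≤ (⌊2 * P4 D⌋₊ : ℝ) ^ (3 / 2 : ℝ) := Real.rpow_nonneg (Nat.cast_nonneg _) _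
    have h2 : 0 ≤ Real.sqrt π / ell2 D := div_nonneg (Real.sqrt_nonneg _) hℓ₂.le
    have hk0 : (0 : ℝ) ≤ ((D * x.p : ℕ) : ℝ) := Nat.cast_nonneg _
    have h16 : (0 : ℝ) ≤ 16 * π ^ 2 := by positivity
    have h3 : 0 ≤ 16 * π ^ 2 * S * B ^ 2 * ((D * x.p : ℕ) : ℝ) :=
      mul_nonneg (mul_nonneg (mul_nonneg h16 hS0) (sq_nonneg B)) hk0
    have h4 : 0 ≤ Real.exp 1 * (144 * ell D ^ 1038) :=
      mul_nonneg (Real.exp_pos _).le (mul_nonneg (by norm_num) (pow_nonneg hℓ0.le _))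
    rw [hK₃]
    exact mul_nonneg (mul_nonneg (mul_nonneg h3 h1) h2) h4
  have hGbd : ∀ t : ℝ, ‖G t‖ ≤ K₃ * Real.exp (-(1 / (8 * ell2 D ^ 2)) * (t - c) ^ 2) :=
    fun t => norm_lineIntegrand_le_gauss χ hD9 hχ x hκ ha.1 t
  -- pointwise on the segment: `F(v) − G(v+c)` is tiny
  have hseg : ∀ v ∈ Set.uIoc (-L₁) L₁, ‖F v - G (v + c)‖ ≤ 9 * K₃ * Real.exp (-(ell D ^ 519)) := by
    intro v hv
    rw [Set.uIoc_of_le (by linarith : -L₁ ≤ L₁)] at hv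
    have hv1 : -L₁ < v := hv.1
    set s : ℂ := (3 / 2 : ℂ) + ((v + c : ℝ) : ℂ) * I with hs
    have hsF : (1 : ℂ) + SmoothWeight.s0 (t0 D) + (v : ℂ) * I = s := by
      rw [hs, Section7I1Line.seg_point_eq, hc]; push_cast; ring
    have him : s.im = v + c := by simp [hs]
    have him1 : 1 ≤ s.im := by rw [him]; linarith
    have hFv : F v = (Zpc χ x s)⁻¹ * (∑' m : ℕ, κs m * x.ψ (m : ZMod x.p) * (m : ℂ) ^ (-s)) *
        (∑ n ∈ Finset.Icc 1 ⌊2 * P4 D⌋₊, as n * conj (x.ψ (n : ZMod x.p)) * (n : ℂ) ^ (s - 1)) *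
        omegaW D s := by
      simp only [hFdef, hsF]
    have hGv : G (v + c) = GammaFactor.tau (psiChi χ x)⁻¹ * ((D * x.p : ℕ) : ℂ) ^ (s - 1) *
        GammaFactor.varthetaStarOneSub s *
        (∑' m : ℕ, κs m * x.ψ (m : ZMod x.p) * (m : ℂ) ^ (-s)) *
        (∑ n ∈ Finset.Icc 1 ⌊2 * P4 D⌋₊, as n * conj (x.ψ (n : ZMod x.p)) * (n : ℂ) ^ (s - 1)) *
        omegaW D s := by
      simp only [hGdef, hs]
    have hGs : ‖GammaFactor.tau (psiChi χ x)⁻¹ * ((D * x.p : ℕ) : ℂ) ^ (s - 1) *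
        GammaFactor.varthetaStarOneSub s *
        (∑' m : ℕ, κs m * x.ψ (m : ZMod x.p) * (m : ℂ) ^ (-s)) *
        (∑ n ∈ Finset.Icc 1 ⌊2 * P4 D⌋₊, as n * conj (x.ψ (n : ZMod x.p)) * (n : ℂ) ^ (s - 1)) *
        omegaW D s‖ ≤ K₃ := by
      have h1 := hGbd (v + c)
      rw [hGv] at h1
      have hE : Real.exp (-(1 / (8 * ell2 D ^ 2)) * (v + c - c) ^ 2) ≤ 1 := by
        apply Real.exp_le_one_iff.mpr
        have h1 : 0 ≤ 1 / (8 * ell2 D ^ 2) :=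
          div_nonneg zero_le_one (mul_nonneg (by norm_num) (pow_nonneg hℓ₂.le 2))
        have h2 := mul_nonneg h1 (sq_nonneg (v + c - c))
        linarith
      calc _ ≤ K₃ * Real.exp (-(1 / (8 * ell2 D ^ 2)) * (v + c - c) ^ 2) := h1
        _ ≤ K₃ * 1 := mul_le_mul_of_nonneg_left hE hK₃0
        _ = K₃ := mul_one _
    have hexp : 9 * Real.exp (-π * s.im) ≤ 9 * Real.exp (-(ell D ^ 519)) := by
      apply mul_le_mul_of_nonneg_left _ (by norm_num)
      apply Real.exp_le_exp.mpr
      rw [him]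
      have : ell D ^ 519 ≤ v + c := by linarith
      nlinarith [Real.pi_gt_three]
    rw [hFv, hGv]
    calc _ ≤ _ := norm_segment_integrand_sub_le χ hD3 hχ x κs as (s := s) him1
      _ ≤ K₃ * (9 * Real.exp (-(ell D ^ 519))) :=
          mul_le_mul hGs hexp (by positivity) hK₃0
      _ = 9 * K₃ * Real.exp (-(ell D ^ 519)) := by ring
  -- interval integrability on the segment
  have hFcont : ContinuousOn F (Set.uIcc (-L₁) L₁) := by
    intro v hv
    rw [Set.uIcc_of_le (by linarith : -L₁ ≤ L₁)] at hv
    have hpos : 0 < 2 * π * t0 D + v := by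
      have : ell D ^ 519 ≤ c + v := by linarith [hv.1]
      rw [hc] at this; linarith
    exact (continuousAt_segment_integrand χ hD3 hχ x hκ as hpos).continuousWithinAt
  have hFi : IntervalIntegrable F volume (-L₁) L₁ := hFcont.intervalIntegrable
  have hGshift_cont : Continuous fun v : ℝ => G (v + c) :=
    (continuous_lineIntegrand χ x hκ as).comp (continuous_id.add continuous_const)
  have hGi : IntervalIntegrable (fun v : ℝ => G (v + c)) volume (-L₁) L₁ :=
    hGshift_cont.intervalIntegrable _ _
  have hsegInt : ‖(∫ v in (-L₁)..L₁, F v) - ∫ v in (-L₁)..L₁, G (v + c)‖ ≤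
      9 * K₃ * Real.exp (-(ell D ^ 519)) * |L₁ - (-L₁)| := by
    rw [← intervalIntegral.integral_sub hFi hGi]
    exact intervalIntegral.norm_integral_le_of_norm_le_const hseg
  -- the line integral splits into the segment and the two tails
  have hsplit : ∫ t : ℝ, G t = (∫ t in Set.Iic (c - L₁), G t) +
      ((∫ v in (-L₁)..L₁, G (v + c)) + ∫ t in Set.Ioi (c + L₁), G t) := by
    have h1 := intervalIntegral.integral_Iic_add_Ioi (hGint.integrableOn (s := Set.Iic (c - L₁)))
      (hGint.integrableOn (s := Set.Ioi (c - L₁)))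
    have h2 := intervalIntegral.integral_Ioi_sub_Ioi (hGint.integrableOn (s := Set.Ioi (c - L₁)))
      (by linarith : c - L₁ ≤ c + L₁)
    have h3 : ∫ t in (c - L₁)..(c + L₁), G t = ∫ v in (-L₁)..L₁, G (v + c) := by
      rw [intervalIntegral.integral_comp_add_right G c]
      congr 1 <;> ring
    rw [← h1, ← h3]
    have h2' : ∫ t in Set.Ioi (c - L₁), G t =
        (∫ t in (c - L₁)..(c + L₁), G t) + ∫ t in Set.Ioi (c + L₁), G t := by
      rw [← h2]; ring
    rw [h2']
  -- the two tails
  set γ : ℝ := L₁ / (8 * ell2 D ^ 2) with hγ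
  have h8 : 0 < 8 * ell2 D ^ 2 := mul_pos (by norm_num) (pow_pos hℓ₂ 2)
  have hγ0 : 0 < γ := by
    rw [hγ]
    refine div_pos ?_ h8
    rw [hL₁, ell1]; exact pow_pos hℓ0 405
  have htailR : ‖∫ t in Set.Ioi (c + L₁), G t‖ ≤ K₃ * (Real.exp (-γ * L₁) / γ) := by
    have hpt : ∀ t ∈ Set.Ioi (c + L₁), ‖G t‖ ≤ K₃ * Real.exp (γ * c) * Real.exp (-γ * t) := by
      intro t ht
      have htc : L₁ ≤ t - c := by have := Set.mem_Ioi.mp ht; linarith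
      refine (hGbd t).trans ?_
      rw [show K₃ * Real.exp (γ * c) * Real.exp (-γ * t) = K₃ * Real.exp (γ * c + -γ * t) by
        rw [Real.exp_add]; ring]
      apply mul_le_mul_of_nonneg_left _ hK₃0
      apply Real.exp_le_exp.mpr
      have key : L₁ * (t - c) ≤ (t - c) ^ 2 := by nlinarith
      have h1 : -(1 / (8 * ell2 D ^ 2)) * (t - c) ^ 2 ≤ -(L₁ / (8 * ell2 D ^ 2)) * (t - c) := by
        rw [show -(1 / (8 * ell2 D ^ 2)) * (t - c) ^ 2 = -((t - c) ^ 2) / (8 * ell2 D ^ 2) by ring,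
          show -(L₁ / (8 * ell2 D ^ 2)) * (t - c) = -(L₁ * (t - c)) / (8 * ell2 D ^ 2) by ring]
        exact div_le_div_of_nonneg_right (by linarith) h8.le
      have h2 : -(L₁ / (8 * ell2 D ^ 2)) * (t - c) = γ * c + -γ * t := by rw [hγ]; ring
      linarith
    have hgi : IntegrableOn (fun t => K₃ * Real.exp (γ * c) * Real.exp (-γ * t))
        (Set.Ioi (c + L₁)) :=
      (integrableOn_exp_mul_Ioi (by linarith : -γ < 0) _).const_mul _
    have hb := norm_integral_le_of_norm_le hgi
      ((ae_restrict_iff' measurableSet_Ioi).mpr (ae_of_all _ hpt))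
    refine hb.trans_eq ?_
    rw [integral_const_mul, integral_exp_mul_Ioi (by linarith : -γ < 0)]
    have : Real.exp (γ * c) * (-Real.exp (-γ * (c + L₁)) / -γ) = Real.exp (-γ * L₁) / γ := by
      rw [neg_div_neg_eq, ← mul_div_assoc, ← Real.exp_add]
      congr 1; ring_nf
    rw [mul_assoc, this]
  have htailL : ‖∫ t in Set.Iic (c - L₁), G t‖ ≤ K₃ * (Real.exp (-γ * L₁) / γ) := by
    have hpt : ∀ t ∈ Set.Iic (c - L₁), ‖G t‖ ≤ K₃ * Real.exp (-γ * c) * Real.exp (γ * t) := by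
      intro t ht
      have htc : L₁ ≤ c - t := by have := Set.mem_Iic.mp ht; linarith
      refine (hGbd t).trans ?_
      rw [show K₃ * Real.exp (-γ * c) * Real.exp (γ * t) = K₃ * Real.exp (-γ * c + γ * t) by
        rw [Real.exp_add]; ring]
      apply mul_le_mul_of_nonneg_left _ hK₃0
      apply Real.exp_le_exp.mpr
      have key : L₁ * (c - t) ≤ (t - c) ^ 2 := by nlinarith
      have h1 : -(1 / (8 * ell2 D ^ 2)) * (t - c) ^ 2 ≤ -(L₁ / (8 * ell2 D ^ 2)) * (c - t) := by
        rw [show -(1 / (8 * ell2 D ^ 2)) * (t - c) ^ 2 = -((t - c) ^ 2) / (8 * ell2 D ^ 2) by ring,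
          show -(L₁ / (8 * ell2 D ^ 2)) * (c - t) = -(L₁ * (c - t)) / (8 * ell2 D ^ 2) by ring]
        exact div_le_div_of_nonneg_right (by linarith) h8.le
      have h2 : -(L₁ / (8 * ell2 D ^ 2)) * (c - t) = -γ * c + γ * t := by rw [hγ]; ring
      linarith
    have hgi : IntegrableOn (fun t => K₃ * Real.exp (-γ * c) * Real.exp (γ * t))
        (Set.Iic (c - L₁)) :=
      (integrableOn_exp_mul_Iic hγ0 _).const_mul _
    have hb := norm_integral_le_of_norm_le hgi
      ((ae_restrict_iff' measurableSet_Iic).mpr (ae_of_all _ hpt))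
    refine hb.trans_eq ?_
    rw [integral_const_mul, integral_exp_mul_Iic hγ0]
    have : Real.exp (-γ * c) * (Real.exp (γ * (c - L₁)) / γ) = Real.exp (-γ * L₁) / γ := by
      rw [← mul_div_assoc, ← Real.exp_add]
      congr 1; ring_nf
    rw [mul_assoc, this]
  -- the value of the tail majorant: `e^{−γ𝓛₁}/γ = 8𝓛³⁹⁵ e^{−𝓛¹⁰/8}`
  have hγval : Real.exp (-γ * L₁) / γ = 8 * ell D ^ 395 * Real.exp (-(ell D ^ 10) / 8) := by
    have hℓne : ell D ≠ 0 := hℓ0.ne'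
    have e1 : -γ * L₁ = -(ell D ^ 10) / 8 := by
      rw [hγ, hL₁, ell1, ell2]; field_simp
    have e2 : 1 / γ = 8 * ell D ^ 395 := by
      rw [hγ, hL₁, ell1, ell2]; field_simp
    rw [div_eq_mul_one_div, e1, e2]; ring
  -- assemble
  have hdiff : i2Tilde χ x κs as - 1 / (2 * π) * ∫ t : ℝ, G t =
      (1 / (2 * π) : ℂ) * (((∫ v in (-L₁)..L₁, F v) - ∫ v in (-L₁)..L₁, G (v + c)) -
        (∫ t in Set.Iic (c - L₁), G t) - ∫ t in Set.Ioi (c + L₁), G t) := by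
    rw [hI2, hsplit]; ring
  have hnormc : ‖(1 / (2 * π) : ℂ)‖ ≤ 1 := by
    rw [show (1 / (2 * π) : ℂ) = ((1 / (2 * π) : ℝ) : ℂ) by push_cast; ring, Complex.norm_real,
      Real.norm_of_nonneg (by positivity), div_le_one (by positivity)]
    linarith [Real.pi_gt_three]
  have hK3 := K3_le (B := B) hD9 x hS0
  have hpre := prefactor_le hD1 hℓ64
  have h395 : ell D ^ 395 ≤ ell D ^ 405 := Section6TailBounds.ell_pow_le_pow hD9 (by norm_num)
  have hexp519 : Real.exp (-(ell D ^ 519)) ≤ Real.exp (-(ell D ^ 10) / 8) := by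
    apply Real.exp_le_exp.mpr
    have : ell D ^ 10 ≤ ell D ^ 519 := Section6TailBounds.ell_pow_le_pow hD9 (by norm_num)
    linarith [pow_pos hℓ0 10]
  have hL₁abs : |L₁ - (-L₁)| = 2 * ell D ^ 405 := by
    rw [hL₁, ell1, sub_neg_eq_add, abs_of_nonneg (by positivity)]; ring
  have hE8 : 0 ≤ Real.exp (-(ell D ^ 10) / 8) := (Real.exp_pos _).le
  have hDP0 : 0 ≤ (D : ℝ) * bigP D ^ 3 :=
    mul_nonneg (Nat.cast_nonneg D) (pow_nonneg (Real.exp_pos _).le 3)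
  rw [hdiff, norm_mul]
  calc ‖(1 / (2 * π) : ℂ)‖ * ‖((∫ v in (-L₁)..L₁, F v) - ∫ v in (-L₁)..L₁, G (v + c)) -
          (∫ t in Set.Iic (c - L₁), G t) - ∫ t in Set.Ioi (c + L₁), G t‖
      ≤ 1 * (‖(∫ v in (-L₁)..L₁, F v) - ∫ v in (-L₁)..L₁, G (v + c)‖ +
          ‖∫ t in Set.Iic (c - L₁), G t‖ + ‖∫ t in Set.Ioi (c + L₁), G t‖) := by
        apply mul_le_mul hnormc _ (norm_nonneg _) zero_le_one
        exact (norm_sub_le _ _).trans (add_le_add (norm_sub_le _ _) le_rfl)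
    _ ≤ 9 * K₃ * Real.exp (-(ell D ^ 519)) * |L₁ - (-L₁)| +
          K₃ * (Real.exp (-γ * L₁) / γ) + K₃ * (Real.exp (-γ * L₁) / γ) := by
        rw [one_mul]; exact add_le_add (add_le_add hsegInt htailL) htailR
    _ = K₃ * (18 * ell D ^ 405 * Real.exp (-(ell D ^ 519)) +
          16 * ell D ^ 395 * Real.exp (-(ell D ^ 10) / 8)) := by rw [hγval, hL₁abs]; ring
    _ ≤ K₃ * (18 * ell D ^ 405 * Real.exp (-(ell D ^ 10) / 8) +
          16 * ell D ^ 405 * Real.exp (-(ell D ^ 10) / 8)) := by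
        apply mul_le_mul_of_nonneg_left _ hK₃0
        gcongr
    _ = 34 * (K₃ * ell D ^ 405 * Real.exp (-(ell D ^ 10) / 8)) := by ring
    _ ≤ 34 * ((324 * 144 * Real.exp 1 * π ^ 2 * S * B ^ 2 * ((D : ℝ) * bigP D ^ 3 * ell D ^ 2076)) *
          ell D ^ 405 * Real.exp (-(ell D ^ 10) / 8)) := by
        gcongr
    _ = 34 * 324 * 144 * Real.exp 1 * π ^ 2 * S * B ^ 2 *
          ((D : ℝ) * bigP D ^ 3 * ell D ^ 2481 * Real.exp (-(ell D ^ 10) / 8)) := by ring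
    _ ≤ 34 * 324 * 144 * Real.exp 1 * π ^ 2 * S * B ^ 2 * Real.exp (-(1 / 16) * ell D ^ 10) := by
        apply mul_le_mul_of_nonneg_left hpre
        have h0 : (0 : ℝ) ≤ 34 * 324 * 144 * Real.exp 1 * π ^ 2 :=
          mul_nonneg (mul_nonneg (by norm_num) (Real.exp_pos _).le) (sq_nonneg π)
        exact mul_nonneg (mul_nonneg h0 hS0) (sq_nonneg B)

end Literature.NumberTheory.LFunctions.Zhang2022.Typed.Sec14.U004
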